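import Summits.CriticalPhenomena.PercolationContinuityZ3.Theorems.Transplant.SkelPhiFaceNumsYx2V
import Summits.CriticalPhenomena.PercolationContinuityZ3.Theorems.Transplant.SkelPhiFaceNumsMkX4EVQ
import HarnessLib
/-!
# WAVE-Q binder row «SkelPhiFaceNumsYx2V» ↦ «SkelPhiFaceNumsYx2VQ» (quasi-step rung (N3-b); captain gen-1 g4, WAVE-Q-BINDER-rows v0.7/v0.8, row Q17; family stmt-g33 = «SkelPhiCorridor*» / «SkelPhiFace*»):
# **THE X4-SHAPED NUMBERS AT A y′-FACE FROM LINEAR FLOORS UNDER EXACT-FOOTPRINT QUASI-STEPS** — `Skelφ.numsYx_of_floors₂EVQ`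

builds on p205010 (kernel theorem, internal audit signed; external expert review pending) — nothing in this file uses p205010; nothing here is a claim about any open node (the
quasi-step node's statement, name and wording are a lead's).  Lane `prim-bschramm`, seat `prim-bschramm-stmt` gen 33 (port pen).  Helper file (`--supports stmt-CriticalPhenomena-4575 --as helper`);
def-free.  PORT RULES (captain #6109/#6122 hunk classes; R-2 port-only-in-cone): of the two declarations of the tree module «SkelPhiFaceNumsYx2V» (sha256 4ba9946f27caed6d…, imported), ONLY the
in-cone one `Skelφ.numsYx_of_floors₂EV` ((F) column, (R-49)(c2b)) is twinned — its first resident `Skelφ.numsX_of_floors₂V` reads «SkelPhiFaceNumsMkX4V», a census-EXTERNAL module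
(outside the used cone of p486426), and is dropped.  Statement and proof BYTE-IDENTICAL except: (i) the binder `(hstep : Steps G φ) ↦ {M : ℕ} (hq : Skelφ.QStepsN G φ M)`;
(ii) `faceRunNumsX4_mkEV hstep ↦ faceRunNumsX4_mkEVQ hq` («SkelPhiFaceNumsMkX4EVQ» p512303); (iv) FLOOR ×M (p5-g28's pull list): the run-origin radius slots of the two floor
hypotheses `hπ2X : M·‖yL‖₁ + (Nr+1)·shearUnit ≤ r`, `hπ3X : ∀ k ≤ N₃, M·‖yT‖₁ + (column radius k) ≤ r` with `yT = yL + crossOffX …` (the column summand keeps the structure's shape).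
Regression: `M = 1` is the original.  Docstrings and citations are the original's.
-/
noncomputable section

open scoped Classical

namespace Summit.CriticalPhenomena.PercolationContinuityZ3.Theorems.Transplant

namespace Skelφ

open Literature.Probability.Percolation Literature.Probability.LatticeModels SimpleGraph KNCells
open Literature.Probability.Percolation.KozmaNitzan
open Literature.Probability.Percolation.KozmaNitzan.Cells (oth oth_ne sgOf sgOf_sign stepVec_apply_fst eq_oth_of_ne oth_oth)
open KNLevels ChainPlanar ChainPara
open Literature.Barriers.CriticalPhenomena (graphBall mem_graphBall_self graphBall_mono)
open BoxProdZ2 (ConcRadiiG)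
open TwoAxis.Para (modulus coarse lam0 lam1)

variable {V : Type} [DecidableEq V] {G : SimpleGraph V} [G.LocallyFinite] {φ : V → Site 2}

/-- **THE X4-SHAPED NUMBERS AT A y′-FACE FROM LINEAR FLOORS** ((R-49)(c2b): x-run first from the bridge landing, y′-run second, target on the
y′-run's last core; `σT := sgOf du`; see the module docstring). [cite: KozmaNitzan2024, §4 Lemma 11–12 (pp. 21–25)] -/
theorem numsYx_of_floors₂EVQ {M : ℕ} (hq : QStepsN G φ M) (pr : FinePrm) (w₀ : V) {nL : ℕ} (hn : pr.n = nL) (hnL : 1 ≤ nL) (hvL : |pr.vα| ≤ nL)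
    (hD : 0 < pr.D) (hlipψ : Lip G (pr.ψ φ w₀)) (hws : WeakSteps G (pr.ψ φ w₀))
    -- the lattice in stride units
    {κ₀ κ₁ mod Vb : ℤ} (hA : 0 < pr.A) (hκ₀ : 0 ≤ κ₀) (hVb : |pr.vα| ≤ Vb) (hc0 : pr.c₀ = pr.A * κ₀) (hc1 : pr.c₁ = pr.A * κ₁)
    (hmod : modulus nL pr.h pr.vα pr.vβ = mod) (hmod0 : 0 < mod) (hDm : pr.D = pr.A ^ 2 * mod)
    {ℓ' : ℕ} (hlay : (nL + pr.h.natAbs : ℕ) ≤ (nL : ℤ) * ℓ' + 1) (hmodlo : (nL : ℤ) * ℓ' - (shearUnit nL pr.h : ℤ) + 1 ≤ mod)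
    (hmodhi : mod ≤ (nL : ℤ) * ℓ')
    -- the face step and the centre
    (P : PCells2V) (Λ : ConcRadiiG) (b₀ : Fin 2 → ℕ) (a' : ℕ) (x : Site 2) (du : MDir) (hdu : du.1 = 1) (j : ℕ) {L' : ℕ} (hL' : 1 ≤ L')
    (hrM : L' ≤ Λ.rM a' (x + stepVec du)) {k₀ : ℤ} (hk₀ : 0 ≤ k₀) {r : ℕ} (c : V) (hcw : c ∈ graphBall G w₀ (Λ.rE a' x du - r))
    (hrE : r ≤ Λ.rE a' x du) (Mz : ℕ)
    {wc : ℤ} (hwc : |pr.ψ φ w₀ c (oth du.1) - P.cenS x (oth du.1)| ≤ wc)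
    {flo fhi fw : ℤ} (hflo : 5 * (P.r du.1 : ℤ) + 10 * P.s du.1 * j + 3 ≤ flo + P.lev du x (pr.ψ φ w₀ c))
    (hfhi : fhi + P.lev du x (pr.ψ φ w₀ c) ≤ 25 * P.r du.1 - 2) (hfw : fw + wc + k₀ + 1 + P.c du.1 ≤ 5 * (P.r (oth du.1) : ℤ) - 3)
    {kpar kperp : ℤ} (hfR : flo ≤ -kpar ∧ kpar ≤ fhi ∧ kperp ≤ fw)
    (Zc : Finset V) {kZ : ℤ} (hZk : ∀ v ∈ Zc, |pr.ψ φ c v du.1| ≤ kZ) (hZfar : P.lev du x (pr.ψ φ w₀ c) + kZ + 1 < 20 * (P.r du.1 : ℤ) - b₀ du.1)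
    -- the run data and the choices
    (B : BridgePrm) (R's qB R'₃ qB₃ : ℕ) (yL : Site 2) (Nr N₃ : ℕ)
    -- floors: the x-run FIRST, from the bridge landing yL, read at a y′-face (`_yface` shapes; sign sgOf du)
    (FX1 : sgOf du = 1 → ∀ k ≤ Nr, mod * (flo - coarse pr.c₁ (pr.D / 2) pr.D (lam1 pr.A nL pr.h yL)) ≤
      -(κ₁ * (shearUnit nL pr.h : ℤ) * (xBoxB nL ℓ' pr.h R's k + 1)) - mod + 1)
    (FX2 : sgOf du = 1 → ∀ k ≤ Nr, mod * (coarse pr.c₁ (pr.D / 2) pr.D (lam1 pr.A nL pr.h yL) + 1) +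
      κ₁ * ((shearUnit nL pr.h : ℤ) * xBoxB nL ℓ' pr.h R's k + shearUnit nL pr.h - 1) ≤ mod * fhi)
    (FX3 : sgOf du = -1 → ∀ k ≤ Nr, mod * (flo + coarse pr.c₁ (pr.D / 2) pr.D (lam1 pr.A nL pr.h yL) + 1) ≤
      -(κ₁ * ((shearUnit nL pr.h : ℤ) * xBoxB nL ℓ' pr.h R's k + shearUnit nL pr.h - 1)))
    (FX4 : sgOf du = -1 → ∀ k ≤ Nr, -(mod * coarse pr.c₁ (pr.D / 2) pr.D (lam1 pr.A nL pr.h yL)) +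
      κ₁ * (shearUnit nL pr.h : ℤ) * (xBoxB nL ℓ' pr.h R's k + 1) + mod - 1 ≤ mod * fhi)
    (FX5 : ∀ k ≤ Nr, (nL : ℤ) * mod * (-fw - coarse pr.c₀ (pr.D / 2) pr.D (lam0 pr.A pr.vα pr.vβ yL)) ≤
      κ₀ * mod * xSLo nL qB R's (sgOf du) k - κ₀ * Vb * (shearUnit nL pr.h : ℤ) * (xBoxB nL ℓ' pr.h R's k + 1) - κ₀ * nL - nL * mod)
    (FX6 : ∀ k ≤ Nr, (nL : ℤ) * mod * (coarse pr.c₀ (pr.D / 2) pr.D (lam0 pr.A pr.vα pr.vβ yL) + 1) +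
      κ₀ * mod * xSHi nL qB R's (sgOf du) k + κ₀ * Vb * (shearUnit nL pr.h : ℤ) * (xBoxB nL ℓ' pr.h R's k + 1) ≤ nL * mod * fw)
    -- floors: the y′-run SECOND, from yT := yL + crossOffX … (sign sgOf du), read at a y′-face
    (FY1 : sgOf du = 1 → ∀ k ≤ N₃, mod * (flo - coarse pr.c₁ (pr.D / 2) pr.D (lam1 pr.A nL pr.h (yL + crossOffX nL pr.h pr.vα (sgOf du) (sgOf du) Nr))) ≤
      κ₁ * ((shearUnit nL pr.h : ℤ) * (ySLo nL ℓ' pr.h qB₃ R'₃ 1 k - 1)) - mod + 1)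
    (FY2 : sgOf du = 1 → ∀ k ≤ N₃, mod * (coarse pr.c₁ (pr.D / 2) pr.D (lam1 pr.A nL pr.h (yL + crossOffX nL pr.h pr.vα (sgOf du) (sgOf du) Nr)) + 1) +
      κ₁ * ((shearUnit nL pr.h : ℤ) * ySHi nL ℓ' pr.h qB₃ R'₃ 1 k + shearUnit nL pr.h - 1) ≤ mod * fhi)
    (FY3 : sgOf du = -1 → ∀ k ≤ N₃, mod * (flo + coarse pr.c₁ (pr.D / 2) pr.D (lam1 pr.A nL pr.h (yL + crossOffX nL pr.h pr.vα (sgOf du) (sgOf du) Nr)) + 1) ≤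
      -(κ₁ * ((shearUnit nL pr.h : ℤ) * ySHi nL ℓ' pr.h qB₃ R'₃ (-1) k + shearUnit nL pr.h - 1)))
    (FY4 : sgOf du = -1 → ∀ k ≤ N₃, -(mod * coarse pr.c₁ (pr.D / 2) pr.D (lam1 pr.A nL pr.h (yL + crossOffX nL pr.h pr.vα (sgOf du) (sgOf du) Nr))) -
      κ₁ * ((shearUnit nL pr.h : ℤ) * (ySLo nL ℓ' pr.h qB₃ R'₃ (-1) k - 1)) + mod - 1 ≤ mod * fhi)
    (FY5 : ∀ k ≤ N₃, (nL : ℤ) * mod * (-fw - coarse pr.c₀ (pr.D / 2) pr.D (lam0 pr.A pr.vα pr.vβ (yL + crossOffX nL pr.h pr.vα (sgOf du) (sgOf du) Nr))) ≤ -(κ₀ * (yBnd nL ℓ' pr.h mod qB₃ R'₃ k + 2 * nL)) - nL * mod)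
    (FY6 : ∀ k ≤ N₃, (nL : ℤ) * mod * (coarse pr.c₀ (pr.D / 2) pr.D (lam0 pr.A pr.vα pr.vβ (yL + crossOffX nL pr.h pr.vα (sgOf du) (sgOf du) Nr)) + 1) + κ₀ * (yBnd nL ℓ' pr.h mod qB₃ R'₃ k + nL) ≤ nL * mod * fw)
    -- floors: the target box on the last core
    (FL1 : (nL : ℤ) * mod * (P.cenS (x + stepVec du) 0 - b₀ 0 + 2 - pr.ψ φ w₀ c 0 -
      coarse pr.c₀ (pr.D / 2) pr.D (lam0 pr.A pr.vα pr.vβ (yL + crossOffX nL pr.h pr.vα (sgOf du) (sgOf du) Nr))) ≤ -(κ₀ * (yBndC nL pr.h mod qB₃ R'₃ (N₃ + 1) + 2 * nL)) - nL * mod)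
    (FL2 : (nL : ℤ) * mod * (coarse pr.c₀ (pr.D / 2) pr.D (lam0 pr.A pr.vα pr.vβ (yL + crossOffX nL pr.h pr.vα (sgOf du) (sgOf du) Nr)) + 1) +
      κ₀ * (yBndC nL pr.h mod qB₃ R'₃ (N₃ + 1) + nL) ≤ nL * mod * (P.cenS (x + stepVec du) 0 + b₀ 0 - 2 - pr.ψ φ w₀ c 0))
    (FL3 : mod * (P.cenS (x + stepVec du) 1 - b₀ 1 + 2 - pr.ψ φ w₀ c 1 - coarse pr.c₁ (pr.D / 2) pr.D (lam1 pr.A nL pr.h (yL + crossOffX nL pr.h pr.vα (sgOf du) (sgOf du) Nr))) ≤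
      κ₁ * ((shearUnit nL pr.h : ℤ) * (yCSLo nL ℓ' pr.h qB₃ R'₃ (sgOf du) (N₃ + 1) - 1)) - mod + 1)
    (FL4 : mod * (coarse pr.c₁ (pr.D / 2) pr.D (lam1 pr.A nL pr.h (yL + crossOffX nL pr.h pr.vα (sgOf du) (sgOf du) Nr)) + 1) +
      κ₁ * ((shearUnit nL pr.h : ℤ) * yCSHi nL ℓ' pr.h qB₃ R'₃ (sgOf du) (N₃ + 1) + shearUnit nL pr.h - 1) ≤ mod * (P.cenS (x + stepVec du) 1 + b₀ 1 - 2 - pr.ψ φ w₀ c 1))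
    -- the cross link floors
    (hfit : (qB : ℤ) + ((Nr : ℤ) + 1) * R's ≤ nL) (hq₃ : ((nL * ℓ' / shearUnit nL pr.h + 1 : ℕ) : ℤ) + ((Nr : ℤ) + 1) * R's + 2 ≤ qB₃)
    -- the bridge box, clearances, reaches
    (hxaX : ∀ x ∈ Finset.Icc B.core1Lo B.core1Hi, |x 0 - sgOf du * yL 0| ≤ qB)
    (hxbX : ∀ x ∈ Finset.Icc B.core1Lo B.core1Hi,
      |sgOf du * ((nL : ℤ) * (x 1 - yL 1) - pr.h * (sgOf du * x 0 - yL 0))| + shearUnit nL pr.h ≤ ((nL * ℓ' / shearUnit nL pr.h + 1 : ℕ) : ℤ) * shearUnit nL pr.h)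
    (hclr : ∀ k ≤ Nr, (Mz : ℤ) < xBoxLoA nL qB R's k + sgOf du * yL 0)
    (hclr₃ : ∀ k ≤ N₃, (∀ b : ℤ, min ((sgOf du) * yBoxLoT nL pr.vα R'₃ k) ((sgOf du) * yBoxHiT nL pr.vα R'₃ k) ≤ b →
      b ≤ max ((sgOf du) * yBoxLoT nL pr.vα R'₃ k) ((sgOf du) * yBoxHiT nL pr.vα R'₃ k) → (Mz : ℤ) < sgOf du * (b + (yL + crossOffX nL pr.h pr.vα (sgOf du) (sgOf du) Nr) 0)) ∨
      ((shearUnit nL pr.h : ℤ) * Mz + |(nL : ℤ) * (yL + crossOffX nL pr.h pr.vα (sgOf du) (sgOf du) Nr) 1 - pr.h * (yL + crossOffX nL pr.h pr.vα (sgOf du) (sgOf du) Nr) 0| <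
        (shearUnit nL pr.h : ℤ) * yBoxLoS nL ℓ' pr.h qB₃ R'₃ k))
    (hπ2X : M * ((yL 0).natAbs + (yL 1).natAbs) + (Nr + 1) * shearUnit nL pr.h ≤ r)
    (hπ3X : ∀ k ≤ N₃, M * (((yL + crossOffX nL pr.h pr.vα (sgOf du) (sgOf du) Nr) 0).natAbs + ((yL + crossOffX nL pr.h pr.vα (sgOf du) (sgOf du) Nr) 1).natAbs) +
      (((((k + 1 : ℕ) : ℤ) * pr.vα).natAbs +
      (((shearUnit nL pr.h : ℤ) * |((k + 1 : ℕ) : ℤ) * (yPrmW nL ℓ' pr.h pr.vα R'₃ qB₃ N₃).sLo| + |pr.h| * |((k + 1 : ℕ) : ℤ) * pr.vα| + shearUnit nL pr.h) / nL).natAbs + 1))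
      ≤ r) :
    ∃ N : FaceRunNumsX4 G φ (pr.ψ φ w₀) c pr.A nL pr.h pr.vα pr.vβ pr.c₀ pr.c₁ pr.D du (sgOf du) B ℓ' R's qB R'₃ qB₃ pr.vα hnL hvL hlay Mz
      (P.farCore x du j k₀) (targetMMV G φ pr P w₀ Λ b₀ a' x du L') Zc r kpar kperp, N.Nr = Nr ∧ N.N₃ = N₃ ∧ N.σT = sgOf du := by
  set yT := yL + crossOffX nL pr.h pr.vα (sgOf du) (sgOf du) Nr with hyT
  have hσ := sgOf_sign du
  -- the three footprint packages
  obtain ⟨PLO, PHI, hreg, hP0, hP1, hP2, hP3, hPf₁, hPf₂, hPf₃⟩ :=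
    xRun_footprint_of_floors_yface (vβ := pr.vβ) hnL pr.h hA hκ₀ hc0 hc1 hmod hmod0 hDm hVb yL hσ du hdu ℓ' R's qB Nr FX1 FX2 FX3 FX4 FX5 FX6
  obtain ⟨YLO, YHI, hregY, hY0, hY1, hY2, hY3, hYf₁, hYf₂, hYf₃⟩ :=
    yRun_footprint_of_floors_yface hnL hA hκ₀ hc0 hc1 hmod hmod0 hDm hvL hlay hmodlo hmodhi yT du hdu R'₃ qB₃ N₃ FY1 FY2 FY3 FY4 FY5 FY6
  obtain ⟨LLO, LHI, hlastc, hL0, hL1, hL2, hL3, hglo, hghi⟩ :=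
    lastCore_target_of_floors hnL hA hκ₀ hc0 hc1 hmod hmod0 hDm hvL hlay hmodlo hmodhi yT hσ R'₃ qB₃ N₃ (pr.ψ φ w₀ c) (P.cenS (x + stepVec du)) b₀
      FL1 FL2 FL3 FL4
  -- the numeric cross link
  have hxyX := hxyX_of_floors hnL (h := pr.h) hvL hσ hσ ℓ' R's qB Nr R'₃ qB₃ N₃ hfit hq₃
  have hd : yT - yL = crossOffX nL pr.h pr.vα (sgOf du) (sgOf du) Nr := by rw [hyT, add_sub_cancel_left]
  exact faceRunNumsX4_mkEVQ hq pr w₀ hn hnL hvL hD hlipψ hws P Λ b₀ a' x du j hL' hrM hk₀ c hcw hrE Mz le_rfl le_rfl hwc hflo hfhi hfw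
    hglo hghi hfR Zc hZk hZfar B ℓ' R's qB R'₃ qB₃ hlay yL yT Nr N₃ hσ PLO PHI YLO YHI hreg hregY hlastc hP0 hP1 hP2 hP3 hPf₁ hPf₂ hPf₃
    hY0 hY1 hY2 hY3 hYf₁ hYf₂ hYf₃ hL0 hL1 hL2 hL3 hxaX hxbX (by rw [hd]; exact hxyX) hclr hclr₃ hπ2X hπ3X

end Skelφ

end Summit.CriticalPhenomena.PercolationContinuityZ3.Theorems.Transplant

end
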